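import Summits.AtomisticToContinuum.Crystallization.Theorems.PhononSlackCertificatesPeriodicGivenLayeredRegistry

/-!
# `PricedLinkCensus.StackingHinge` (stmt-AtomisticToContinuum-14993), line `Sketch`, stub `stub_ljDomination`,
# helper 1: a dual-side upper bound for the aligned-minus-offset Gaussian layer sum

The Hägg half-domination `Σ_{k ≥ 3} (k - 1) |J_k| ≤ |J₂| / 2` needs UPPER bounds on `|J_k|`, `k ≥ 3`, exponentially
small in the layer height; through the Bernstein representation (`LayeredHull.reg_barlowCoupling_eq_integral`) this is
an upper bound on the unit-spacing layer sum `G(u) = θ¹_0(u) - θ¹_1(u)`,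
`θ¹_δ(u) = layerInteraction (fun r => Real.exp (-u * r ^ 2)) 1 0 δ 0`, exponentially small as `u → 0`.  By the
Poisson representation `LayeredHull.reg_tsum_plane_poisson`, with `β = 4π²/(3u)`,
`G(u) = (2π/(√3 u)) Σ_{(m,n) ∈ ℤ²} e^{-β (m² - mn + n²)} (1 - cos (2π (m + n)/3))` (the dual lattice of the unit
triangular lattice is `{m ξ₁ + n ξ₂}`: `ljd_dual_exists` is the surjectivity missing from `LayeredHull.reg_mem_dual`);
`1 - cos ≤ 3/2`, the six first-shell vectors, and `4 (m² - mn + n²) ≥ 7 + m² + n²` off the first shell give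
`G(u) ≤ (3π/(√3 u)) (6 e^{-β} + e^{-7β/4} ((1 + e^{-β/4})/(1 - e^{-β/4}))²)` (`ljd_G_le`), numerically
`G(u) ≤ (38/u) e^{-13.159/u}` on `(0, 87/20]` (`stub_ljdGaussBound`).
-/

noncomputable section

namespace Summit.AtomisticToContinuum.Crystallization.Theorems.PricedHcpWindowsLjDomination

open MeasureTheory Set Real Filter Module
open scoped BigOperators
open Literature.MathematicalPhysics.StatisticalMechanics Literature.Algebra.EuclideanLattices
open Summit.AtomisticToContinuum.Crystallization.Theorems.LayeredHull

/-- Coordinates of `m ξ₁ + n ξ₂`, `ξ₁ = (1, -√3/3)`, `ξ₂ = (0, 2√3/3)`. [folklore] -/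
theorem ljd_psi_apply (m n : ℤ) :
    ((m : ℝ) • (!₂[1, -(Real.sqrt 3 / 3)] : EuclideanSpace ℝ (Fin 2)) +
        (n : ℝ) • (!₂[0, 2 * Real.sqrt 3 / 3] : EuclideanSpace ℝ (Fin 2))) 0 = m ∧
      ((m : ℝ) • (!₂[1, -(Real.sqrt 3 / 3)] : EuclideanSpace ℝ (Fin 2)) +
        (n : ℝ) • (!₂[0, 2 * Real.sqrt 3 / 3] : EuclideanSpace ℝ (Fin 2))) 1 = (2 * n - m) * (Real.sqrt 3 / 3) := by
  constructor
  · simp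
  · simp
    ring

/-- `‖m ξ₁ + n ξ₂‖² = m² + (2n - m)²/3 = (4/3)(m² - mn + n²)`. [folklore] -/
theorem ljd_norm_psi_sq (m n : ℤ) :
    ‖(m : ℝ) • (!₂[1, -(Real.sqrt 3 / 3)] : EuclideanSpace ℝ (Fin 2)) +
        (n : ℝ) • (!₂[0, 2 * Real.sqrt 3 / 3] : EuclideanSpace ℝ (Fin 2))‖ ^ 2 =
      4 / 3 * ((m : ℝ) ^ 2 - m * n + n ^ 2) := by
  have h3 : Real.sqrt 3 * Real.sqrt 3 = 3 := Real.mul_self_sqrt (by norm_num)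
  obtain ⟨h0, h1⟩ := ljd_psi_apply m n
  set v := (m : ℝ) • (!₂[1, -(Real.sqrt 3 / 3)] : EuclideanSpace ℝ (Fin 2)) +
    (n : ℝ) • (!₂[0, 2 * Real.sqrt 3 / 3] : EuclideanSpace ℝ (Fin 2)) with hv
  rw [EuclideanSpace.norm_eq, Real.sq_sqrt (by positivity), Fin.sum_univ_two, Real.norm_eq_abs,
    Real.norm_eq_abs, sq_abs, sq_abs, show v.ofLp 0 = v 0 from rfl, show v.ofLp 1 = v 1 from rfl, h0, h1]
  linear_combination ((2 * (n : ℝ) - m) ^ 2 / 9) * h3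

/-- `⟨-(1/2, √3/6), m ξ₁ + n ξ₂⟩ = -(m + n)/3` (the offset coset pairs with the dual vectors in thirds).
[folklore] -/
theorem ljd_inner_psi (m n : ℤ) :
    inner ℝ (-(!₂[1 / 2, Real.sqrt 3 / 6] : EuclideanSpace ℝ (Fin 2)))
        ((m : ℝ) • (!₂[1, -(Real.sqrt 3 / 3)] : EuclideanSpace ℝ (Fin 2)) +
          (n : ℝ) • (!₂[0, 2 * Real.sqrt 3 / 3] : EuclideanSpace ℝ (Fin 2))) = -((m : ℝ) + n) / 3 := by
  have h3 : Real.sqrt 3 * Real.sqrt 3 = 3 := Real.mul_self_sqrt (by norm_num)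
  obtain ⟨h0, h1⟩ := ljd_psi_apply m n
  rw [reg_inner_fin_two, h0, h1]
  simp
  linear_combination (-(2 * (n : ℝ) - m) / 18) * h3

/-- **Every dual vector of the unit triangular lattice is an integer combination `m ξ₁ + n ξ₂`**
(`m = ⟨w, u⟩`, `n = ⟨w, v⟩`). [folklore] -/
theorem ljd_dual_exists (w : EuclideanSpace ℝ (Fin 2))
    (hw : w ∈ dualLattice (Submodule.span ℤ (Set.range
      ⇑(basisOfLinearIndependentOfCardEqFinrank reg_linearIndependent_plane reg_card_eq_finrank_plane)))) :
    ∃ mn : ℤ × ℤ, (mn.1 : ℝ) • (!₂[1, -(Real.sqrt 3 / 3)] : EuclideanSpace ℝ (Fin 2)) +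
        (mn.2 : ℝ) • (!₂[0, 2 * Real.sqrt 3 / 3] : EuclideanSpace ℝ (Fin 2)) = w := by
  set bT := basisOfLinearIndependentOfCardEqFinrank reg_linearIndependent_plane reg_card_eq_finrank_plane
    with hbT
  rw [mem_dualLattice] at hw
  have hb0 : (!₂[1, 0] : EuclideanSpace ℝ (Fin 2)) ∈ Submodule.span ℤ (Set.range ⇑bT) :=
    Submodule.subset_span ⟨0, by rw [hbT, reg_planeBasis_apply]; rfl⟩
  have hb1 : (!₂[1 / 2, Real.sqrt 3 / 2] : EuclideanSpace ℝ (Fin 2)) ∈ Submodule.span ℤ (Set.range ⇑bT) :=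
    Submodule.subset_span ⟨1, by rw [hbT, reg_planeBasis_apply]; rfl⟩
  obtain ⟨m, hm⟩ := hw _ hb0
  obtain ⟨n, hn⟩ := hw _ hb1
  rw [reg_inner_fin_two] at hm hn
  simp at hm hn
  have h3 : Real.sqrt 3 * Real.sqrt 3 = 3 := Real.mul_self_sqrt (by norm_num)
  obtain ⟨h0, h1⟩ := ljd_psi_apply m n
  refine ⟨(m, n), ?_⟩
  ext i
  fin_cases i
  · exact h0.trans hm
  · refine h1.trans (?_ : _ = w 1)
    rw [hn, hm]
    linear_combination (w 1 / 3) * h3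

/-- **Sums over the dual lattice are sums over `ℤ × ℤ`** through `(m, n) ↦ m ξ₁ + n ξ₂` (a bijection onto the
dual lattice: `LayeredHull.reg_mem_dual` and `ljd_dual_exists`). [folklore] -/
theorem ljd_tsum_dual_eq (f : EuclideanSpace ℝ (Fin 2) → ℝ) :
    ∑' w : dualLattice (Submodule.span ℤ (Set.range
      ⇑(basisOfLinearIndependentOfCardEqFinrank reg_linearIndependent_plane reg_card_eq_finrank_plane))),
        f (w : EuclideanSpace ℝ (Fin 2)) =
      ∑' mn : ℤ × ℤ, f ((mn.1 : ℝ) • (!₂[1, -(Real.sqrt 3 / 3)] : EuclideanSpace ℝ (Fin 2)) +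
        (mn.2 : ℝ) • (!₂[0, 2 * Real.sqrt 3 / 3] : EuclideanSpace ℝ (Fin 2))) := by
  set L := Submodule.span ℤ (Set.range
    ⇑(basisOfLinearIndependentOfCardEqFinrank reg_linearIndependent_plane reg_card_eq_finrank_plane)) with hL
  set ψ : ℤ × ℤ → dualLattice L := fun mn =>
    ⟨(mn.1 : ℝ) • (!₂[1, -(Real.sqrt 3 / 3)] : EuclideanSpace ℝ (Fin 2)) +
      (mn.2 : ℝ) • (!₂[0, 2 * Real.sqrt 3 / 3] : EuclideanSpace ℝ (Fin 2)), reg_mem_dual mn.1 mn.2⟩ with hψ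
  have hs3 : 0 < Real.sqrt 3 := by positivity
  have hinj : Function.Injective ψ := by
    rintro ⟨m, n⟩ ⟨m', n'⟩ h
    have h0 := congrArg (fun w : dualLattice L => (w : EuclideanSpace ℝ (Fin 2)) 0) h
    have h1 := congrArg (fun w : dualLattice L => (w : EuclideanSpace ℝ (Fin 2)) 1) h
    simp only [hψ, (ljd_psi_apply _ _).1, (ljd_psi_apply _ _).2] at h0 h1
    have hm : m = m' := by exact_mod_cast h0
    subst hm
    have hn : (n : ℝ) = n' := by nlinarith [hs3]
    have hn' : n = n' := by exact_mod_cast hn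
    rw [hn']
  have hsurj : Function.Surjective ψ := fun w => by
    obtain ⟨mn, hmn⟩ := ljd_dual_exists (w : EuclideanSpace ℝ (Fin 2)) w.2
    exact ⟨mn, Subtype.ext hmn⟩
  exact ((Equiv.ofBijective ψ ⟨hinj, hsurj⟩).tsum_eq (fun w : dualLattice L => f w)).symm

/-- `cos (2π q / 3) ≥ -1/2` for every integer `q` (the values are `1` and `-1/2`). [folklore] -/
theorem ljd_cos_ge (q : ℤ) : -(1 / 2 : ℝ) ≤ Real.cos (2 * π * q / 3) := by
  have hq : q = q % 3 + 3 * (q / 3) := (Int.emod_add_mul_ediv q 3).symm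
  have h0 : 0 ≤ q % 3 := Int.emod_nonneg q (by norm_num)
  have h3 : q % 3 < 3 := Int.emod_lt_of_pos q (by norm_num)
  have hper : Real.cos (2 * π * q / 3) = Real.cos (2 * π * ((q % 3 : ℤ) : ℝ) / 3) := by
    conv_lhs => rw [hq]
    push_cast
    rw [show 2 * π * (((q % 3 : ℤ) : ℝ) + 3 * ((q / 3 : ℤ) : ℝ)) / 3 =
      2 * π * ((q % 3 : ℤ) : ℝ) / 3 + ((q / 3 : ℤ) : ℝ) * (2 * π) by ring, Real.cos_add_int_mul_two_pi]
  have hc1 : Real.cos (2 * π / 3) = -(1 / 2) := by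
    rw [show 2 * π / 3 = π - π / 3 by ring, Real.cos_pi_sub, Real.cos_pi_div_three]
  have hc2 : Real.cos (4 * π / 3) = -(1 / 2) := by
    rw [show 4 * π / 3 = π / 3 + π by ring, Real.cos_add_pi, Real.cos_pi_div_three]
  rw [hper]
  rcases (show q % 3 = 0 ∨ q % 3 = 1 ∨ q % 3 = 2 by omega) with h | h | h <;> rw [h] <;> push_cast
  · rw [mul_zero, zero_div, Real.cos_zero]
    norm_num
  · rw [mul_one, hc1]
  · rw [show 2 * π * 2 / 3 = 4 * π / 3 by ring, hc2]

/-- Off the origin and the first shell `m² - mn + n² = 1` (six vectors) the dual quadratic form satisfies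
`4 (m² - mn + n²) ≥ 7 + m² + n²`. [folklore] -/
theorem ljd_quad (m n : ℤ) :
    (m, n) ∈ ({(0, 0), (1, 0), (-1, 0), (0, 1), (0, -1), (1, 1), (-1, -1)} : Finset (ℤ × ℤ)) ∨
      7 + m ^ 2 + n ^ 2 ≤ 4 * (m ^ 2 - m * n + n ^ 2) := by
  by_cases h : -2 ≤ m ∧ m ≤ 2 ∧ -2 ≤ n ∧ n ≤ 2
  · obtain ⟨h1, h2, h3, h4⟩ := h
    interval_cases m <;> interval_cases n <;> decide
  · right
    have h9 : 9 ≤ m ^ 2 + n ^ 2 := by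
      by_contra hlt
      apply h
      refine ⟨?_, ?_, ?_, ?_⟩ <;> nlinarith [sq_nonneg m, sq_nonneg n]
    nlinarith [sq_nonneg (m - n)]

/-- The dual-side term at `(m, n)` is at most `(3/2) e^{-β}` on the first shell plus
`(3/2) e^{-7β/4} e^{-β m²/4} e^{-β n²/4}` (it vanishes at the origin). [folklore] -/
theorem ljd_term_le {β : ℝ} (hβ : 0 ≤ β) (m n : ℤ) :
    Real.exp (-(β * ((m : ℝ) ^ 2 - m * n + n ^ 2))) * (1 - Real.cos (2 * π * (-((m : ℝ) + n) / 3))) ≤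
      3 / 2 * Real.exp (-β) *
          (if (m, n) ∈ ({(1, 0), (-1, 0), (0, 1), (0, -1), (1, 1), (-1, -1)} : Finset (ℤ × ℤ)) then 1 else 0) +
        3 / 2 * Real.exp (-(7 / 4 * β)) *
          (Real.exp (-(β / 4 * (m : ℝ) ^ 2)) * Real.exp (-(β / 4 * (n : ℝ) ^ 2))) := by
  have hcos : 1 - Real.cos (2 * π * (-((m : ℝ) + n) / 3)) ≤ 3 / 2 := by
    have h := ljd_cos_ge (-(m + n))
    push_cast at h
    rw [show 2 * π * (-((m : ℝ) + n)) / 3 = 2 * π * (-((m : ℝ) + n) / 3) by ring] at h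
    linarith
  have hcos0 : 0 ≤ 1 - Real.cos (2 * π * (-((m : ℝ) + n) / 3)) := sub_nonneg.2 (Real.cos_le_one _)
  have hB : 0 ≤ 3 / 2 * Real.exp (-(7 / 4 * β)) *
      (Real.exp (-(β / 4 * (m : ℝ) ^ 2)) * Real.exp (-(β / 4 * (n : ℝ) ^ 2))) := by positivity
  rcases ljd_quad m n with hT | hQ
  · by_cases h00 : (m, n) = (0, 0)
    · simp only [Prod.mk.injEq] at h00
      obtain ⟨rfl, rfl⟩ := h00
      have h0 : (1 : ℝ) - Real.cos (2 * π * (-(((0 : ℤ) : ℝ) + ((0 : ℤ) : ℝ)) / 3)) = 0 := by simp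
      rw [h0, mul_zero]
      positivity
    · have hT6 : (m, n) ∈ ({(1, 0), (-1, 0), (0, 1), (0, -1), (1, 1), (-1, -1)} : Finset (ℤ × ℤ)) := by
        simp only [Finset.mem_insert, Finset.mem_singleton] at hT ⊢
        tauto
      have hQ1 : (m : ℝ) ^ 2 - m * n + n ^ 2 = 1 := by
        simp only [Finset.mem_insert, Finset.mem_singleton, Prod.mk.injEq] at hT6
        rcases hT6 with ⟨rfl, rfl⟩ | ⟨rfl, rfl⟩ | ⟨rfl, rfl⟩ | ⟨rfl, rfl⟩ | ⟨rfl, rfl⟩ | ⟨rfl, rfl⟩ <;>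
          push_cast <;> norm_num
      rw [if_pos hT6, hQ1, mul_one, mul_one]
      nlinarith [mul_le_mul_of_nonneg_left hcos (Real.exp_pos (-β)).le]
  · have hQ' : (7 : ℝ) + (m : ℝ) ^ 2 + (n : ℝ) ^ 2 ≤ 4 * ((m : ℝ) ^ 2 - m * n + n ^ 2) := by
      exact_mod_cast hQ
    have hexp : Real.exp (-(β * ((m : ℝ) ^ 2 - m * n + n ^ 2))) ≤
        Real.exp (-(7 / 4 * β)) * (Real.exp (-(β / 4 * (m : ℝ) ^ 2)) * Real.exp (-(β / 4 * (n : ℝ) ^ 2))) := by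
      rw [← Real.exp_add, ← Real.exp_add, Real.exp_le_exp]
      nlinarith [mul_le_mul_of_nonneg_left hQ' hβ]
    have hA : 0 ≤ 3 / 2 * Real.exp (-β) *
        (if (m, n) ∈ ({(1, 0), (-1, 0), (0, 1), (0, -1), (1, 1), (-1, -1)} : Finset (ℤ × ℤ)) then (1 : ℝ)
          else 0) := by
      split_ifs <;> positivity
    calc Real.exp (-(β * ((m : ℝ) ^ 2 - m * n + n ^ 2))) * (1 - Real.cos (2 * π * (-((m : ℝ) + n) / 3)))
        ≤ Real.exp (-(β * ((m : ℝ) ^ 2 - m * n + n ^ 2))) * (3 / 2) :=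
          mul_le_mul_of_nonneg_left hcos (Real.exp_pos _).le
      _ ≤ Real.exp (-(7 / 4 * β)) * (Real.exp (-(β / 4 * (m : ℝ) ^ 2)) * Real.exp (-(β / 4 * (n : ℝ) ^ 2))) *
          (3 / 2) := mul_le_mul_of_nonneg_right hexp (by norm_num)
      _ = 3 / 2 * Real.exp (-(7 / 4 * β)) *
          (Real.exp (-(β / 4 * (m : ℝ) ^ 2)) * Real.exp (-(β / 4 * (n : ℝ) ^ 2))) := by ring
      _ ≤ _ := le_add_of_nonneg_left hA

/-- **The dual-side sum**: for `β > 0`,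
`Σ_{(m,n)} e^{-β(m² - mn + n²)} (1 - cos(2π(-(m+n))/3)) ≤ (3/2)(6 e^{-β} + e^{-7β/4} ((1 + e^{-β/4})/(1 - e^{-β/4}))²)`
(first shell, plus a product of two geometric-dominated Gaussian sums). [folklore] -/
theorem ljd_sum_le {β : ℝ} (hβ : 0 < β) :
    ∑' mn : ℤ × ℤ, Real.exp (-(β * ((mn.1 : ℝ) ^ 2 - mn.1 * mn.2 + mn.2 ^ 2))) *
        (1 - Real.cos (2 * π * (-((mn.1 : ℝ) + mn.2) / 3))) ≤
      3 / 2 * (6 * Real.exp (-β) +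
        Real.exp (-(7 / 4 * β)) * ((1 + Real.exp (-(β / 4))) / (1 - Real.exp (-(β / 4)))) ^ 2) := by
  set T₆ : Finset (ℤ × ℤ) := {(1, 0), (-1, 0), (0, 1), (0, -1), (1, 1), (-1, -1)} with hT₆
  set A : ℤ × ℤ → ℝ := fun mn => 3 / 2 * Real.exp (-β) * (if mn ∈ T₆ then 1 else 0) with hA
  set B : ℤ × ℤ → ℝ := fun mn => 3 / 2 * Real.exp (-(7 / 4 * β)) *
    (Real.exp (-(β / 4 * (mn.1 : ℝ) ^ 2)) * Real.exp (-(β / 4 * (mn.2 : ℝ) ^ 2))) with hB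
  have hc : 0 < β / 4 := by positivity
  obtain ⟨hs1, hb1⟩ := reg_tsum_exp_neg_mul_sq_le hc
  have hs1' : Summable fun n : ℤ => ‖Real.exp (-(β / 4 * (n : ℝ) ^ 2))‖ :=
    hs1.congr fun n => (Real.norm_of_nonneg (Real.exp_pos _).le).symm
  have hBs : Summable B := (summable_mul_of_summable_norm hs1' hs1').mul_left _
  have hAzero : ∀ mn ∉ T₆, A mn = 0 := fun mn hmn => by simp only [hA, if_neg hmn, mul_zero]
  have hAs : Summable A := summable_of_ne_finset_zero hAzero
  have hA0 : ∀ mn, 0 ≤ A mn := fun mn => by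
    simp only [hA]
    split_ifs <;> positivity
  have hB0 : ∀ mn, 0 ≤ B mn := fun mn => by
    simp only [hB]
    positivity
  have hAval : ∀ mn ∈ T₆, A mn = 3 / 2 * Real.exp (-β) := fun mn hmn => by
    simp only [hA, if_pos hmn, mul_one]
  have hAsum : ∑' mn, A mn = 3 / 2 * Real.exp (-β) * 6 := by
    rw [tsum_eq_sum hAzero, Finset.sum_congr rfl hAval, Finset.sum_const, show T₆.card = 6 by rfl,
      nsmul_eq_mul]
    push_cast
    ring
  have hS0 : 0 ≤ ∑' n : ℤ, Real.exp (-(β / 4 * (n : ℝ) ^ 2)) := tsum_nonneg fun n => (Real.exp_pos _).le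
  have hBsum : ∑' mn, B mn ≤ 3 / 2 * Real.exp (-(7 / 4 * β)) *
      ((1 + Real.exp (-(β / 4))) / (1 - Real.exp (-(β / 4)))) ^ 2 := by
    simp only [hB]
    rw [tsum_mul_left, ← tsum_mul_tsum_of_summable_norm hs1' hs1', ← sq]
    exact mul_le_mul_of_nonneg_left (pow_le_pow_left₀ hS0 hb1 2) (by positivity)
  have hle : ∀ mn : ℤ × ℤ, Real.exp (-(β * ((mn.1 : ℝ) ^ 2 - mn.1 * mn.2 + mn.2 ^ 2))) *
      (1 - Real.cos (2 * π * (-((mn.1 : ℝ) + mn.2) / 3))) ≤ A mn + B mn := fun mn =>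
    ljd_term_le hβ.le mn.1 mn.2
  have h0 : ∀ mn : ℤ × ℤ, 0 ≤ Real.exp (-(β * ((mn.1 : ℝ) ^ 2 - mn.1 * mn.2 + mn.2 ^ 2))) *
      (1 - Real.cos (2 * π * (-((mn.1 : ℝ) + mn.2) / 3))) := fun mn =>
    mul_nonneg (Real.exp_pos _).le (sub_nonneg.2 (Real.cos_le_one _))
  refine Real.tsum_le_of_sum_le h0 fun u => ?_
  calc ∑ mn ∈ u, Real.exp (-(β * ((mn.1 : ℝ) ^ 2 - mn.1 * mn.2 + mn.2 ^ 2))) *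
        (1 - Real.cos (2 * π * (-((mn.1 : ℝ) + mn.2) / 3)))
      ≤ ∑ mn ∈ u, (A mn + B mn) := Finset.sum_le_sum fun mn _ => hle mn
    _ ≤ ∑' mn, (A mn + B mn) :=
        Summable.sum_le_tsum u (fun mn _ => add_nonneg (hA0 mn) (hB0 mn)) (hAs.add hBs)
    _ = ∑' mn, A mn + ∑' mn, B mn := hAs.tsum_add hBs
    _ ≤ _ := by rw [hAsum]; linarith

/-- **Dual-side upper bound for the aligned-minus-offset Gaussian layer sum** (unit spacing): for `u > 0`, with
`β = 4π²/(3u)`,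
`θ¹_0(u) - θ¹_1(u) ≤ (2π/(√3 u)) (3/2) (6 e^{-β} + e^{-7β/4} ((1 + e^{-β/4})/(1 - e^{-β/4}))²)`.
By Poisson summation the difference is `(2π/(√3 u)) Σ_{ξ ∈ Λ*} e^{-π² ‖ξ‖²/u} (1 - cos 2π⟨w, ξ⟩)`
(`LayeredHull.reg_tsum_plane_poisson`), the dual lattice is `{m ξ₁ + n ξ₂}` (`ljd_tsum_dual_eq`), and the
terms are bounded by `ljd_term_le`. [folklore] -/
theorem ljd_G_le {u : ℝ} (hu : 0 < u) :
    layerInteraction (fun r => Real.exp (-u * r ^ 2)) 1 0 0 0 -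
        layerInteraction (fun r => Real.exp (-u * r ^ 2)) 1 0 1 0 ≤
      2 / Real.sqrt 3 * (π / u) * (3 / 2 * (6 * Real.exp (-(4 * π ^ 2 / (3 * u))) +
        Real.exp (-(7 / 4 * (4 * π ^ 2 / (3 * u)))) *
          ((1 + Real.exp (-(4 * π ^ 2 / (3 * u) / 4))) / (1 - Real.exp (-(4 * π ^ 2 / (3 * u) / 4)))) ^ 2)) := by
  set β : ℝ := 4 * π ^ 2 / (3 * u) with hβ
  have hβ0 : 0 < β := by positivity
  set x₁ : EuclideanSpace ℝ (Fin 2) := -(!₂[1 / 2, Real.sqrt 3 / 6] : EuclideanSpace ℝ (Fin 2)) with hx₁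
  have e0 : layerInteraction (fun r => Real.exp (-u * r ^ 2)) 1 0 0 0 =
      ∑' ij : ℤ × ℤ, Real.exp (-u * ‖(ij.1 : ℝ) • (!₂[1, 0] : EuclideanSpace ℝ (Fin 2)) +
        (ij.2 : ℝ) • !₂[1 / 2, Real.sqrt 3 / 2] - 0‖ ^ 2) := by
    rw [layerInteraction]
    exact tsum_congr fun ij => by rw [reg_norm_plane_zero]
  have e1 : layerInteraction (fun r => Real.exp (-u * r ^ 2)) 1 0 1 0 =
      ∑' ij : ℤ × ℤ, Real.exp (-u * ‖(ij.1 : ℝ) • (!₂[1, 0] : EuclideanSpace ℝ (Fin 2)) +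
        (ij.2 : ℝ) • !₂[1 / 2, Real.sqrt 3 / 2] - x₁‖ ^ 2) := by
    rw [layerInteraction]
    exact tsum_congr fun ij => by rw [hx₁, reg_norm_plane_one]
  set f : EuclideanSpace ℝ (Fin 2) → ℝ := fun w =>
    Real.exp (-(π ^ 2 * ‖w‖ ^ 2 / u)) * (1 - Real.cos (2 * π * inner ℝ x₁ w)) with hf
  have hdiff : layerInteraction (fun r => Real.exp (-u * r ^ 2)) 1 0 0 0 -
      layerInteraction (fun r => Real.exp (-u * r ^ 2)) 1 0 1 0 =
      2 / Real.sqrt 3 * (π / u) * ∑' w : dualLattice (Submodule.span ℤ (Set.range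
        ⇑(basisOfLinearIndependentOfCardEqFinrank reg_linearIndependent_plane reg_card_eq_finrank_plane))),
          f (w : EuclideanSpace ℝ (Fin 2)) := by
    rw [e0, e1, reg_tsum_plane_poisson hu 0, reg_tsum_plane_poisson hu x₁, ← mul_sub,
      ← Summable.tsum_sub (reg_summable_dual hu 0) (reg_summable_dual hu x₁)]
    congr 1
    refine tsum_congr fun w => ?_
    simp only [hf, inner_zero_left, mul_zero, Real.cos_zero, mul_one]
    ring
  have hψ : ∑' w : dualLattice (Submodule.span ℤ (Set.range
      ⇑(basisOfLinearIndependentOfCardEqFinrank reg_linearIndependent_plane reg_card_eq_finrank_plane))),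
        f (w : EuclideanSpace ℝ (Fin 2)) =
      ∑' mn : ℤ × ℤ, Real.exp (-(β * ((mn.1 : ℝ) ^ 2 - mn.1 * mn.2 + mn.2 ^ 2))) *
        (1 - Real.cos (2 * π * (-((mn.1 : ℝ) + mn.2) / 3))) := by
    rw [ljd_tsum_dual_eq f]
    refine tsum_congr fun mn => ?_
    simp only [hf, hx₁, ljd_norm_psi_sq, ljd_inner_psi, hβ]
    congr 2
    field_simp
  rw [hdiff, hψ]
  exact mul_le_mul_of_nonneg_left (ljd_sum_le hβ0) (by positivity)

/-- `4π²/3 ≥ 13.159`. [folklore] -/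
theorem ljd_alpha_ge : (13159 / 1000 : ℝ) ≤ 4 * π ^ 2 / 3 := by
  have h := Real.pi_gt_d6
  nlinarith [Real.pi_pos]

/-- `√3 π ≤ 5.4415`. [folklore] -/
theorem ljd_sqrt3_pi_le : Real.sqrt 3 * π ≤ 54415 / 10000 := by
  have h1 := Real.pi_lt_d6
  have hs : Real.sqrt 3 ≤ 17320509 / 10000000 := by
    rw [show (17320509 / 10000000 : ℝ) = Real.sqrt ((17320509 / 10000000) ^ 2) by rw [Real.sqrt_sq (by norm_num)]]
    exact Real.sqrt_le_sqrt (by norm_num)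
  have hs0 : 0 ≤ Real.sqrt 3 := Real.sqrt_nonneg 3
  nlinarith [Real.pi_pos]

/-- **`G(u) ≤ (38/u) e^{-13.159/u}` for `0 < u ≤ 87/20`** (the deliverable of this file, in registrable form).
From `ljd_G_le`: with `β = 4π²/(3u) ≥ 13.159/u`, `e^{-β/4} ≤ e^{-0.756} ≤ 0.47`, `e^{-3β/4} ≤ e^{-2.268} ≤ 0.1038`,
`√3 π ≤ 5.4415`, and `5.4415 (6 + 0.1038 (1.47/0.53)²) ≤ 38`. [folklore] -/
theorem stub_ljdGaussBound : ∀ u : ℝ, 0 < u → u ≤ 87 / 20 → Literature.MathematicalPhysics.StatisticalMechanics.layerInteraction (fun r => Real.exp (-u * r ^ 2)) 1 0 0 0 - Literature.MathematicalPhysics.StatisticalMechanics.layerInteraction (fun r => Real.exp (-u * r ^ 2)) 1 0 1 0 ≤ 38 / u * Real.exp (-(13159 / 1000 / u)) := by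
  intro u hu huτ
  have h := ljd_G_le hu
  set β : ℝ := 4 * π ^ 2 / (3 * u) with hβ
  have hβ' : β = (4 * π ^ 2 / 3) / u := by rw [hβ]; field_simp
  have hαu : 13159 / 1000 / u ≤ β := by
    rw [hβ']
    exact div_le_div_of_nonneg_right ljd_alpha_ge hu.le
  have hx0 : (13159 / 17400 : ℝ) ≤ β / 4 := by
    have h1 : 13159 / 1000 / (87 / 20) ≤ 13159 / 1000 / u :=
      div_le_div_of_nonneg_left (by norm_num) hu huτ
    linarith
  -- `r = e^{-β/4} ≤ 0.47`
  have hr : Real.exp (-(β / 4)) ≤ 47 / 100 := by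
    have h5 := Real.sum_le_exp_of_nonneg (by norm_num : (0 : ℝ) ≤ 13159 / 17400) 5
    simp only [Finset.sum_range_succ, Finset.sum_range_zero, Nat.factorial] at h5
    norm_num at h5
    calc Real.exp (-(β / 4)) ≤ Real.exp (-(13159 / 17400)) := Real.exp_le_exp.2 (by linarith)
      _ = (Real.exp (13159 / 17400))⁻¹ := Real.exp_neg _
      _ ≤ (100 / 47)⁻¹ := inv_anti₀ (by norm_num) (le_trans (by norm_num) h5)
      _ = 47 / 100 := by norm_num
  have hr0 : 0 ≤ Real.exp (-(β / 4)) := (Real.exp_pos _).le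
  -- `e^{-3β/4} ≤ 0.1038`
  have hE : Real.exp (-(7 / 4 * β)) ≤ Real.exp (-β) * (1038 / 10000) := by
    have h2 := reg_exp_neg_le 2 (f := 3 * (13159 / 17400) - 2) (by norm_num)
    rw [show -(7 / 4 * β) = -β + -(3 * (β / 4)) by ring, Real.exp_add]
    refine mul_le_mul_of_nonneg_left ?_ (Real.exp_pos _).le
    calc Real.exp (-(3 * (β / 4))) ≤ Real.exp (-(((2 : ℕ) : ℝ) + (3 * (13159 / 17400) - 2))) :=
          Real.exp_le_exp.2 (by push_cast; linarith)
      _ ≤ _ := h2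
      _ ≤ 1038 / 10000 := by norm_num
  -- the ratio
  have hq : ((1 + Real.exp (-(β / 4))) / (1 - Real.exp (-(β / 4)))) ^ 2 ≤ ((1 + 47 / 100) / (1 - 47 / 100)) ^ 2 := by
    refine pow_le_pow_left₀ (div_nonneg (by linarith) (by linarith)) ?_ 2
    rw [div_le_div_iff₀ (by linarith) (by norm_num)]
    nlinarith
  have hexpβ : Real.exp (-β) ≤ Real.exp (-(13159 / 1000 / u)) := Real.exp_le_exp.2 (by linarith)
  have hpre : 2 / Real.sqrt 3 * (π / u) * (3 / 2) = Real.sqrt 3 * π / u := by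
    have h3 : Real.sqrt 3 * Real.sqrt 3 = 3 := Real.mul_self_sqrt (by norm_num)
    have hs0 : 0 < Real.sqrt 3 := by positivity
    field_simp
    nlinarith [h3]
  have hb4 : Real.exp (-(4 * π ^ 2 / (3 * u) / 4)) = Real.exp (-(β / 4)) := by rw [hβ]
  rw [hb4] at h
  calc layerInteraction (fun r => Real.exp (-u * r ^ 2)) 1 0 0 0 -
        layerInteraction (fun r => Real.exp (-u * r ^ 2)) 1 0 1 0
      ≤ 2 / Real.sqrt 3 * (π / u) * (3 / 2 * (6 * Real.exp (-β) +
          Real.exp (-(7 / 4 * β)) * ((1 + Real.exp (-(β / 4))) / (1 - Real.exp (-(β / 4)))) ^ 2)) := h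
    _ = Real.sqrt 3 * π / u * (6 * Real.exp (-β) +
          Real.exp (-(7 / 4 * β)) * ((1 + Real.exp (-(β / 4))) / (1 - Real.exp (-(β / 4)))) ^ 2) := by
        rw [← hpre]
        ring
    _ ≤ Real.sqrt 3 * π / u * (6 * Real.exp (-β) +
          Real.exp (-β) * (1038 / 10000) * ((1 + 47 / 100) / (1 - 47 / 100)) ^ 2) := by
        gcongr
    _ = Real.sqrt 3 * π * (6 + 1038 / 10000 * ((1 + 47 / 100) / (1 - 47 / 100)) ^ 2) / u * Real.exp (-β) := by
        field_simp
    _ ≤ 38 / u * Real.exp (-(13159 / 1000 / u)) := by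
        gcongr
        nlinarith [ljd_sqrt3_pi_le, Real.pi_pos, Real.sqrt_nonneg 3]

end Summit.AtomisticToContinuum.Crystallization.Theorems.PricedHcpWindowsLjDomination
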